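import Mathlib
import Summits.NavierStokesRegularity.NavierStokesRegularity.Theorems.EulerZoomLiouvillePowerGaugeEulerLiouvilleChiralAnchorFlow
import Summits.NavierStokesRegularity.NavierStokesRegularity.Theorems.EulerZoomLiouvillePowerGaugeEulerLiouvilleSwirlfreeLedgerConfinement
import Literature.Analysis.FluidPDE.ClassicalSolution
import Literature.Analysis.FluidPDE.AxisymmetricEuler
import HarnessLib

/-!
# Crux `EulerZoomLiouville.PowerGaugeEulerLiouville` (stmt-NavierStokesRegularity-19832), width sub-line `casimir_haul` (ns-idea-11 g10),
# stub H1 `stub_ledgerFlow`: MEMBERS OF THE HAULABLE STRATUM HAVE LEDGER FLOWS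

Seat ns-sfl-p1 g10 (`--supports stmt-NavierStokesRegularity-19832 --as helper`; LEAD 19832 ns-typeII-p2 g16's key request 08:46:45Z:
«H1 `stub_ledgerFlow` (S/M, flow package à la `CasimirFloorTransport`)»).  The line `Cruxes/PowerGaugeEulerLiouville/Lines/casimir_haul.lean`
registers `Sig.stub_ledgerFlow : ∀ u p, IsSlabBoundedSwirlFree u p → HasLedgerFlows u`; this file proves it with the line's abbreviations
(`IsSlabBoundedSwirlFree`, `HasLedgerFlows`, `IsLedgerFlow`, `ledgerBlob`) δ-UNFOLDED in the tree's vocabulary, so the skeleton fills the stub by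
`theorem stub_ledgerFlow : Sig.stub_ledgerFlow := CasimirHaul.hasLedgerFlows_of_slabBoundedSwirlFree`.

THE STATEMENT.  Let `(u, p)` be a classical Euler solution on `(−∞,0) × ℝ³` whose slices are axisymmetric and swirl-free and whose velocity is
bounded on every compact past time-slab.  Then for every `t₀ < 0`, `t₁ < t₀`, `λ > 0`, `R₀ > 0`, the marked CASIMIR BLOB
`S = {x ∈ B̄(0,R₀) : λ·r(x) ≤ ‖curl u(t₀, x)‖}` is carried on `[t₁, t₀]` by a LEDGER FLOW `X`: jointly continuous, `X t₀ = id` on `S`, trajectories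
solving `ẋ = u(s, x)` within `[t₁,t₀]`, injective on `S`, with measurable images of the same volume and the `ℝ≥0∞` change of variables, all images in
one ball, and THE LEDGER FLOOR `λ·r(X s x) ≤ ‖curl u(s, X s x)‖` along every trajectory from `S`.

THE PROOF re-assembles two landed packages BY NAME.  (i) With the slab bound `‖u‖ ≤ B` on `[t₁,t₀] × ℝ³` and a bump `φ` with plateau radius
`(R₀+1) + 3B(t₀−t₁) + 2`, ns-ezl-w3's ★ `ChiralAnchor.isAnchorFlow` (the anchor-flow package of the sibling sub-line `chiral_anchor`, K1) gives
clauses 1–7 for the time-clamped cut-off flow `X r := Ψ_{max t₁ (min r t₀)}`, `Ψ_r = ODE.evolutionMap (fun t x => φ x • u t x) t₀ r`, on ANY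
label set inside `ball 0 (R₀+1)` — in particular on the blob.  (ii) THE FLOOR is the material conservation of `η = ω_θ/r` from this base's
swirl-free calculus (line `swirlfree-ledger`, S2): a label on the symmetry axis stays on the axis (`SwirlfreeLedger.evolutionMap_mem_axis`, the
horizontal velocity of an axisymmetric field vanishes there, `Wei2016.apply_zero_one_eq_zero_of_axis`), where the floor is void (`r = 0`); a label
off the axis stays off it (`SwirlfreeLedger.cylRadius_evolutionMap_ne_zero`) and `‖curl u‖/r = |⟪Jx, curl u⟫/r²|` (`div_cylRadius_eq_abs_omegaTilde`)
is transported pointwise along the cut-off trajectory while it stays in the plateau (`omegaTilde_evolutionMap_eq`, `ChiralAnchor.flow_mem_plateau`),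
so `‖curl u(s, X s x)‖ / r(X s x) = ‖curl u(t₀, x)‖ / r(x) ≥ λ`.

* ★ `hasLedgerFlows_of_slabBoundedSwirlFree` — H1, signature unfolded.

HONEST FRAMING: Lagrangian bookkeeping for a width sub-line of the crux class (the kill is H4 `stub_haulRace`, open; H6 `stub_haulFace` is the
wall); nothing here bears on the crux E (19832 OPEN) or on NS regularity; no summit statement is proved by this file; not E.
[cite: MajdaBertozziCUP2002, §1.3 Prop. 1.4, §2.3.3 (2.58)–(2.59), §4.2 (4.48); Hartman2002, Ch. V Cor. 3.1]
-/

noncomputable section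

-- flat `Theorems/<Route><Decl>…` files of one crux share the namespace of the crux (tree convention)
set_option linter.dupNamespace false

open MeasureTheory Set Filter Topology Metric Function
open scoped NNReal ENNReal ContDiff RealInnerProductSpace

namespace Summit.NavierStokesRegularity.NavierStokesRegularity.Theorems.PowerGaugeEulerLiouville.CasimirHaul

open Literature.Analysis Literature.Analysis.FluidPDE Literature.Analysis.ODE
open Summit.NavierStokesRegularity.NavierStokesRegularity.Theorems.PowerGaugeEulerLiouville.SwirlfreeLedger
open Summit.NavierStokesRegularity.NavierStokesRegularity.Theorems.PowerGaugeEulerLiouville.ChiralAnchor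
  (window_facts norm_flow_sub_le flow_mem_plateau isAnchorFlow)

/-- ★ **H1 `stub_ledgerFlow` of the line `casimir_haul`, signature unfolded** (`∀ u p, IsSlabBoundedSwirlFree u p → HasLedgerFlows u` with the
line's `IsSlabBoundedSwirlFree`, `HasLedgerFlows`, `IsLedgerFlow`, `ledgerBlob` δ-unfolded): on the classical axisymmetric swirl-free stratum with
velocity bounded on compact past slabs, every marked Casimir blob `{x ∈ B̄(0,R₀) : λ r ≤ ‖curl u(t₀)‖}` (`t₀ < 0`, `λ > 0`, `R₀ > 0`) is carried on
every past slab `[t₁,t₀]` by a ledger flow (joint continuity, `X t₀ = id`, trajectories of `u`, injectivity, volume and change of variables,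
confinement to one ball, and the ledger floor `λ r ≤ ‖curl u(s)‖` along trajectories).  Witness: the time-clamped cut-off flow of
`ChiralAnchor.isAnchorFlow`; floor: `SwirlfreeLedger.omegaTilde_evolutionMap_eq` off the axis, `SwirlfreeLedger.evolutionMap_mem_axis` on it.
[cite: MajdaBertozziCUP2002, §1.3 Prop. 1.4, §2.3.3 (2.58)–(2.59), §4.2 (4.48)] -/
theorem hasLedgerFlows_of_slabBoundedSwirlFree :
    ∀ (u : ℝ → EuclideanSpace ℝ (Fin 3) → EuclideanSpace ℝ (Fin 3)) (p : ℝ → EuclideanSpace ℝ (Fin 3) → ℝ),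
      (IsClassicalEulerSolutionOn (Set.Iio 0) 0 u p ∧
          (∀ τ : ℝ, τ < 0 → IsAxisymmetric (u τ) ∧ HasNoSwirl (u τ)) ∧
          (∀ T₁ T₀ : ℝ, T₁ ≤ T₀ → T₀ < 0 → ∃ B : ℝ, ∀ τ ∈ Set.Icc T₁ T₀, ∀ x : EuclideanSpace ℝ (Fin 3), ‖u τ x‖ ≤ B)) →
      ∀ t₀ : ℝ, t₀ < 0 → ∀ t₁ : ℝ, t₁ < t₀ → ∀ lam R₀ : ℝ, 0 < lam → 0 < R₀ →
        ∃ X : ℝ → EuclideanSpace ℝ (Fin 3) → EuclideanSpace ℝ (Fin 3),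
          Continuous (fun q : ℝ × EuclideanSpace ℝ (Fin 3) => X q.1 q.2) ∧
            (∀ x ∈ {x : EuclideanSpace ℝ (Fin 3) | x ∈ Metric.closedBall (0 : EuclideanSpace ℝ (Fin 3)) R₀ ∧
                lam * cylRadius x ≤ ‖curl (u t₀) x‖}, X t₀ x = x) ∧
            (∀ s ∈ Set.Icc t₁ t₀, ∀ x ∈ {x : EuclideanSpace ℝ (Fin 3) | x ∈ Metric.closedBall (0 : EuclideanSpace ℝ (Fin 3)) R₀ ∧
                lam * cylRadius x ≤ ‖curl (u t₀) x‖},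
              HasDerivWithinAt (fun σ : ℝ => X σ x) (u s (X s x)) (Set.Icc t₁ t₀) s) ∧
            (∀ s ∈ Set.Icc t₁ t₀, Set.InjOn (X s) {x : EuclideanSpace ℝ (Fin 3) |
                x ∈ Metric.closedBall (0 : EuclideanSpace ℝ (Fin 3)) R₀ ∧ lam * cylRadius x ≤ ‖curl (u t₀) x‖}) ∧
            (∀ s ∈ Set.Icc t₁ t₀,
              MeasurableSet (X s '' {x : EuclideanSpace ℝ (Fin 3) | x ∈ Metric.closedBall (0 : EuclideanSpace ℝ (Fin 3)) R₀ ∧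
                  lam * cylRadius x ≤ ‖curl (u t₀) x‖}) ∧
                volume (X s '' {x : EuclideanSpace ℝ (Fin 3) | x ∈ Metric.closedBall (0 : EuclideanSpace ℝ (Fin 3)) R₀ ∧
                  lam * cylRadius x ≤ ‖curl (u t₀) x‖}) =
                  volume {x : EuclideanSpace ℝ (Fin 3) | x ∈ Metric.closedBall (0 : EuclideanSpace ℝ (Fin 3)) R₀ ∧
                    lam * cylRadius x ≤ ‖curl (u t₀) x‖}) ∧
            (∀ s ∈ Set.Icc t₁ t₀, ∀ g : EuclideanSpace ℝ (Fin 3) → ℝ≥0∞, Measurable g →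
              ∫⁻ x in X s '' {x : EuclideanSpace ℝ (Fin 3) | x ∈ Metric.closedBall (0 : EuclideanSpace ℝ (Fin 3)) R₀ ∧
                  lam * cylRadius x ≤ ‖curl (u t₀) x‖}, g x =
                ∫⁻ x in {x : EuclideanSpace ℝ (Fin 3) | x ∈ Metric.closedBall (0 : EuclideanSpace ℝ (Fin 3)) R₀ ∧
                  lam * cylRadius x ≤ ‖curl (u t₀) x‖}, g (X s x)) ∧
            (∃ R : ℝ, ∀ s ∈ Set.Icc t₁ t₀,
              X s '' {x : EuclideanSpace ℝ (Fin 3) | x ∈ Metric.closedBall (0 : EuclideanSpace ℝ (Fin 3)) R₀ ∧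
                  lam * cylRadius x ≤ ‖curl (u t₀) x‖} ⊆ Metric.ball (0 : EuclideanSpace ℝ (Fin 3)) R) ∧
            (∀ s ∈ Set.Icc t₁ t₀, ∀ x ∈ {x : EuclideanSpace ℝ (Fin 3) | x ∈ Metric.closedBall (0 : EuclideanSpace ℝ (Fin 3)) R₀ ∧
                lam * cylRadius x ≤ ‖curl (u t₀) x‖},
              lam * cylRadius (X s x) ≤ ‖curl (u s) (X s x)‖) := by
  intro u p hstr t₀ ht₀ t₁ ht₁ lam R₀ _hlam _hR₀
  obtain ⟨hcl, hsym, hslab⟩ := hstr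
  -- the slab bound on `[t₁, t₀]`
  obtain ⟨B, hB⟩ := hslab t₁ t₀ ht₁.le ht₀
  have hB0 : 0 ≤ B := (norm_nonneg _).trans (hB t₀ (right_mem_Icc.2 ht₁.le) 0)
  have hD0 : 0 ≤ B * (t₀ - t₁) := mul_nonneg hB0 (by linarith)
  -- the blob
  set S : Set (EuclideanSpace ℝ (Fin 3)) := {x : EuclideanSpace ℝ (Fin 3) |
    x ∈ Metric.closedBall (0 : EuclideanSpace ℝ (Fin 3)) R₀ ∧ lam * cylRadius x ≤ ‖curl (u t₀) x‖} with hSdef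
  have hSsub : S ⊆ ball (0 : EuclideanSpace ℝ (Fin 3)) (R₀ + 1) := fun x hx =>
    mem_ball_zero_iff.2 (lt_of_le_of_lt (mem_closedBall_zero_iff.1 hx.1) (by linarith))
  have hcurlc : Continuous (curl (u t₀)) := by
    have hv : ContDiff ℝ 1 (u t₀) := (hcl.contDiff_velocity (show t₀ ∈ Set.Iio 0 from ht₀)).of_le (by norm_cast)
    rw [curl_eq_curlCLM_comp]
    exact curlCLM.continuous.comp (hv.continuous_fderiv one_ne_zero)
  have hSm : MeasurableSet S :=
    (isClosed_closedBall.inter (isClosed_le (continuous_const.mul continuous_cylRadius) hcurlc.norm)).measurableSet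
  -- the bump with plateau radius `(R₀ + 1) + 3B(t₀ − t₁) + 2`
  set φ : ContDiffBump (0 : EuclideanSpace ℝ (Fin 3)) :=
    ⟨R₀ + 1 + 3 * (B * (t₀ - t₁)) + 2, R₀ + 1 + 3 * (B * (t₀ - t₁)) + 3, by positivity, by linarith⟩ with hφdef
  have hφ : φ.rIn = R₀ + 1 + 3 * (B * (t₀ - t₁)) + 2 := rfl
  -- the anchor-flow package (clauses 1–7)
  obtain ⟨h1, h2, h3, h4, h5, h6, h7⟩ := isAnchorFlow (φ := φ) hcl ht₁ ht₀ hB hφ hSsub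
  set E : ℝ → EuclideanSpace ℝ (Fin 3) → EuclideanSpace ℝ (Fin 3) :=
    ODE.evolutionMap (fun t x => (φ : EuclideanSpace ℝ (Fin 3) → ℝ) x • u t x) t₀ with hEdef
  refine ⟨fun r y => E (max t₁ (min r t₀)) y, h1, h2, h3, h4, fun s hs => h5 s hs S Subset.rfl hSm,
    fun s hs g hg => h6 s hs S Subset.rfl hSm g hg, h7, ?_⟩
  -- clause 8: THE LEDGER FLOOR along trajectories
  intro s hs x hx
  have hclamp : max t₁ (min s t₀) = s := by rw [min_eq_left hs.2, max_eq_right hs.1]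
  simp only [hclamp]
  -- the open time window and the cut-off field
  obtain ⟨hSo, hSc, hS0, ht₁S, ht₀S, hIcc⟩ := window_facts ht₁ ht₀
  have hclS : IsClassicalEulerSolutionOn (Ioo (t₁ - 1) (t₀ / 2)) 0 u p := hcl.mono hS0 hSo.uniqueDiffOn
  have hsymS : ∀ r ∈ Ioo (t₁ - 1) (t₀ / 2), IsAxisymmetric (u r) := fun r hr => (hsym r (hS0 hr)).1
  have hswS : ∀ r ∈ Ioo (t₁ - 1) (t₀ / 2), HasNoSwirl (u r) := fun r hr => (hsym r (hS0 hr)).2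
  have hsS : s ∈ Ioo (t₁ - 1) (t₀ / 2) := hIcc hs
  have hs0 : s < 0 := hS0 hsS
  have hLip : ODE.IsUniformlyLipschitzOn (fun t z => φ z • u t z) (Ioo (t₁ - 1) (t₀ / 2)) :=
    isUniformlyLipschitzOn_bump_smul φ hSo hclS.smooth_velocity
  have haxisw : ∀ r ∈ Ioo (t₁ - 1) (t₀ / 2), ∀ z : EuclideanSpace ℝ (Fin 3), z 0 = 0 → z 1 = 0 →
      (fun t z => φ z • u t z) r z 0 = 0 ∧ (fun t z => φ z • u t z) r z 1 = 0 := by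
    intro r hr z hz0 hz1
    have h := Wei2016.apply_zero_one_eq_zero_of_axis (hsymS r hr) hz0 hz1
    simp [h.1, h.2]
  have hC2 : ∀ τ : ℝ, τ < 0 → ContDiff ℝ 2 (u τ) := fun τ hτ => (hcl.contDiff_velocity hτ).of_le (by norm_cast)
  by_cases hx0 : cylRadius x = 0
  · -- on the axis: the trajectory stays on the axis, where the floor is void
    obtain ⟨hz0, hz1⟩ := (cylRadius_eq_zero_iff x).1 hx0
    have hax := evolutionMap_mem_axis hLip hSc haxisw ht₀S hsS hz0 hz1
    have hr0 : cylRadius (E s x) = 0 := (cylRadius_eq_zero_iff _).2 hax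
    rw [hr0, mul_zero]
    exact norm_nonneg _
  · -- off the axis: `‖curl u‖ / r` is transported pointwise
    have hgood : ‖x‖ < R₀ + 1 + B * (t₀ - t₁) + 1 := by
      have := mem_closedBall_zero_iff.1 hx.1; linarith
    have hconf : ∀ σ ∈ Icc s t₀, E σ x ∈ ball (0 : EuclideanSpace ℝ (Fin 3)) φ.rIn := fun σ hσ =>
      flow_mem_plateau hcl ht₁ ht₀ hB hφ hgood ⟨hs.1.trans hσ.1, hσ.2⟩
    have hoff : cylRadius (E s x) ≠ 0 := cylRadius_evolutionMap_ne_zero hLip hSc haxisw ht₀S hsS hx0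
    have htr := omegaTilde_evolutionMap_eq hclS hSo hSc hsymS hswS φ hsS ht₀S hs.2 hx0 hconf
    have e0 := div_cylRadius_eq_abs_omegaTilde (hsym t₀ ht₀).1 (hsym t₀ ht₀).2 (hC2 t₀ ht₀) hx0
    have e1 := div_cylRadius_eq_abs_omegaTilde (hsym s hs0).1 (hsym s hs0).2 (hC2 s hs0) hoff
    have hratio : ‖curl (u s) (E s x)‖ / cylRadius (E s x) = ‖curl (u t₀) x‖ / cylRadius x := by
      rw [e0, e1]
      simp only [vorticity_apply] at htr
      rw [htr]
    have hrpos : 0 < cylRadius x := lt_of_le_of_ne (cylRadius_nonneg x) (Ne.symm hx0)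
    have hr'pos : 0 < cylRadius (E s x) := lt_of_le_of_ne (cylRadius_nonneg _) (Ne.symm hoff)
    have hlam' : lam ≤ ‖curl (u t₀) x‖ / cylRadius x := (le_div_iff₀ hrpos).2 hx.2
    rw [← hratio] at hlam'
    exact (le_div_iff₀ hr'pos).1 hlam'

end Summit.NavierStokesRegularity.NavierStokesRegularity.Theorems.PowerGaugeEulerLiouville.CasimirHaul

end
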